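import Literature.NumberTheory.LFunctions.Zhang2022.DetectorDictFormCS
import Literature.NumberTheory.LFunctions.Zhang2022.DetectorDoublingCompose

/-!
# Zhang (2022), programme F-S3 (cell landau-siegel §E, row S-E-p6-3, kernel leaf [K7]): the CIRCLE route for the
# shift dictionary with a FREE APEX — `(π/2)·DictShift_b(G) = c₀·T_b^{[0,1]}(S_G) + (two-point jet form)` for every
# kinked `G` (K1‴), and `DictShift_b(G) ≥ 0` from a unit bridge by Parseval on the circle (K3′) for sign-admissible `b`

Y. Zhang, *Discrete mean estimates and the Landau–Siegel zero*, arXiv:2211.02515v1 [Zhang2022LandauSiegel] —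
an unrefereed manuscript under adjudication. **WHAT THIS IS NOT: not a claim about Theorems 1–2 of
arXiv:2211.02515, about Landau–Siegel zeros, about a repaired `Margin232`, or about Parity. The programme SEARCHES
and TYPES; no claim about Landau–Siegel zeros, Theorems 1–2 of arXiv:2211.02515 or a repaired Margin232 until a
kernel theorem says so.**

CONTEXT. The §E glued row `Repair.familyDetGlued` (`RepairDetGlued`, ls-barrier-p6 g3) displays the slot
`Det.DictShiftPSD b` — the one-form dictionary `Det.DictShift b G G′` (`DetectorDictForm`: six-moment bulk + three apex
terms in `a₁ = G(1)`) non-negative on `H¹` profiles of `[0,1]`, NO apex condition (glued / overlapping two-sided profiles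
included). The cell's identity Id-7 (ls-num-2 g4 2026-08-27T02:56:33Z, two lineages exact; ls-theory PASS) reads
`DictShift_b(G) = (2/π)c₀(b)·T_b^{ℝ/2ℤ}(S̃_G)` with `S̃_G` = the tail primitive `S_G = ∫_y^1 G` on `[0,1]` continued by a
UNIT BRIDGE — the two-point bulk extremal `E` with jets `(E,E′)(0) = (0, −a₁)` and `(E,E′)(1) = (∫G, −a₀)`. This leaf is
the K6-pattern one level up (K6 = the case `a₁ = 0`):

* Part 1 **[K1‴] general-apex closed form** (every kinked `G`, every real triple `b`; only the shift relations
  `m_s = e₁m₀ − m_b`, `m_n + m_bs = e₂m₀`, `m_bn = e₃m₀` are used):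
  `(π/2)·DictShift b G G′ = Re A₀(b)·T_b^{[0,1]}(S_G) + freeEndForm b I (−a₀) + freeEndForm b 0 (−conj a₁) + π·Re crossJet`,
  `a₀ = G(0)`, `a₁ = G(1)`, `I = ∫₀¹G`, `Det.crossJet b a₀ a₁ I := −i(Σ_jW′_j(b) + c_g(b))·a₀·conj a₁ − π·A_N(b)·I·conj a₁`
  (`dictShift_eq_bulk_add_jets`; atoms: `re_shiftCore_self`, `bulkFormOn_tailPrim_eq_re_shiftCore`, the boundary
  identities `two_mul_re_integral_deriv_mul_conj`, `two_mul_re_integral_mul_conj_primitive`);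
* Part 2 **[assembly, interface]** `dictShift_nonneg_of_bridge`: for sign-admissible `b`, kinked `G` and ANY bridge
  `E` on `[0,1]` (continuous `E, E′, E″`, right-derivatives, the four jets, energy
  `c₀·T_b^{[0,1]}(E) = freeEndForm b I (−a₀) + freeEndForm b 0 (−conj a₁) + π·Re crossJet`) ⇒ `0 ≤ DictShift b G G′` —
  glue `E(·+1)` on `[−1,0]` to `S_G` on `[0,1]` (`Det.glue`), periodic `C¹` matching at `∓1` (`0`, `−a₁`) and at the
  node `0` (`I`, `−a₀`), K3′ `bulkFormOn_circle_nonneg_of_signAdmissible` on the cell `[−1,1]` with node set `{0}`,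
  `c₀ > 0` (`Det.re_sum_shiftW_pos`); `dictShiftPSD_kinked_of_bridges` (∀-form over the jets).
* Part 3 (appended when the two-point identity K2″ `Det.twoPointIdentity` — ls-barrier-num g3,
  `DetectorTwoPointIdentity` — is in the tree): the bridge exists for every jet datum ⇒ `DictShift b ≥ 0` on kinked
  profiles for every sign-admissible `b`; Part 4: the `H¹` lift (`Det.DictShiftPSD b`) by the `MainTermFormH1` density
  template.

0 named facts; 0 sorries; standard axioms. Readers: ls-theory g2, ls-num-2 g4 (Id-7 owners).
References: arXiv:2211.02515v1 §4 (4.1); Prop. 7.1 p.44 with (7.2), (8.11)–(8.23); §12 (12.6)–(12.17); Prop. 14.1;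
Lemma 15.1; §18 (18.1). [cite: Zhang2022LandauSiegel, §§4, 7–8, 12, 14–15, 18]
-/

noncomputable section

open Complex Real ComplexConjugate Set MeasureTheory intervalIntegral Topology Filter

namespace Literature.NumberTheory.LFunctions.Zhang2022

namespace Det

open Repair

variable {b : Fin 3 → ℝ} {G G' : ℝ → ℂ}

/-! ### Part 1 — [K1‴] the general-apex closed form of the shift dictionary -/

/-- **The two-point cross jet form** `crossJet b a₀ a₁ I := −i(Σ_jW′_j(b) + c_g(b))·a₀·conj a₁ − π·A_N(b)·I·conj a₁`
(`W′ = Det.shiftGlueW`, `c_g = Det.shiftGlue0`, `A_N = Det.atomAN`): the part of the dictionary's apex block that couples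
the two ends of `[0,1]` (the off-diagonal block of the unit bridge's energy; `= twoPointGlue b I (−a₀) 0 (−conj a₁)` of
the two-point identity K2″). [cite: Zhang2022LandauSiegel, Prop 14.1; Lemma 15.1; §18 (18.1)] -/
def crossJet (b : Fin 3 → ℝ) (a₀ a₁ Ig : ℂ) : ℂ :=
  -I * ((∑ j : Fin 3, shiftGlueW b j) + shiftGlue0 b) * a₀ * conj a₁ - π * atomAN b * Ig * conj a₁

/-- Shift relation `m_s = e₁·m₀ − m_b` for the raw sums (`s_j = e₁ − b_j`; no distinctness needed).
[cite: Zhang2022LandauSiegel, §8 (8.13)–(8.18)] -/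
theorem sum_shiftW_mul_shiftS (b : Fin 3 → ℝ) :
    (∑ j : Fin 3, shiftW b j * (shiftS b j : ℂ)) = (symE1 b : ℂ) * atomA0 b - atomAb b := by
  simp only [atomA0, atomAb, symE1, Fin.sum_univ_three, shiftS, Matrix.cons_val_zero, Matrix.cons_val_one,
    Matrix.cons_val_two, Matrix.head_cons, Matrix.tail_cons]
  push_cast
  ring

/-- Shift relation `m_n + m_bs = e₂·m₀` for the raw sums (`n_j + b_js_j = e₂`). [cite: Zhang2022LandauSiegel, §8 (8.13)–(8.18)] -/
theorem sum_shiftW_mul_shiftN_add (b : Fin 3 → ℝ) :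
    (∑ j : Fin 3, shiftW b j * (shiftN b j : ℂ)) + ∑ j : Fin 3, shiftW b j * ((b j : ℂ) * (shiftS b j : ℂ))
      = (symE2 b : ℂ) * atomA0 b := by
  simp only [atomA0, symE2, Fin.sum_univ_three, shiftS, shiftN, Matrix.cons_val_zero, Matrix.cons_val_one,
    Matrix.cons_val_two, Matrix.head_cons, Matrix.tail_cons]
  push_cast
  ring

/-- Shift relation `m_bn = e₃·m₀` for the raw sums (`b_jn_j = e₃`). [cite: Zhang2022LandauSiegel, §8 (8.13)–(8.18)] -/
theorem sum_shiftW_mul_b_mul_shiftN (b : Fin 3 → ℝ) :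
    (∑ j : Fin 3, shiftW b j * ((b j : ℂ) * (shiftN b j : ℂ))) = (symE3 b : ℂ) * atomA0 b := by
  simp only [atomA0, symE3, Fin.sum_univ_three, shiftN, Matrix.cons_val_zero, Matrix.cons_val_one,
    Matrix.cons_val_two, Matrix.head_cons, Matrix.tail_cons]
  push_cast
  ring

/-- `∫₀¹ G·conj G′ = conj ∫₀¹ G′·conj G`. [folklore] -/
private theorem integral_mul_conj_deriv_eq_conj (G G' : ℝ → ℂ) :
    (∫ x in (0:ℝ)..1, G x * conj (G' x)) = conj (∫ x in (0:ℝ)..1, G' x * conj (G x)) := by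
  have : conj (∫ x in (0:ℝ)..1, G' x * conj (G x)) = ∫ x in (0:ℝ)..1, conj (G' x * conj (G x)) := by
    simp only [intervalIntegral, map_sub, integral_conj]
  rw [this]
  exact intervalIntegral.integral_congr fun x _ => by simp [mul_comm]

/-- **[K1‴] THE GENERAL-APEX CLOSED FORM.** For EVERY real shift triple `b` and EVERY kinked profile `G` on `[0,1]`
(no apex condition), with `S_G = ∫_y^1 G`, `a₀ = G(0)`, `a₁ = G(1)`, `I = ∫₀¹G`:
`(π/2)·DictShift b G G′ = Re A₀(b)·T_b^{[0,1]}(S_G) + freeEndForm b I (−a₀) + freeEndForm b 0 (−conj a₁) + π·Re crossJet b a₀ a₁ I`.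
At `a₁ = 0` this is K1 (`formDet_shiftRecipe_eq_bulk_add_freeEnd`, via `dictShift_eq_formDet`).
[cite: Zhang2022LandauSiegel, §4 (4.1); Prop 7.1 p.44 with (8.11)–(8.23); §18 (18.1)] -/
theorem dictShift_eq_bulk_add_jets (b : Fin 3 → ℝ) (hG : KinkedProfile G G') :
    π / 2 * DictShift b G G'
      = (atomA0 b).re * bulkFormOn b 0 1 (tailPrim G) (fun y => -G y) (fun y => -G' y)
        + freeEndForm b (∫ y in (0:ℝ)..1, G y) (-G 0) + freeEndForm b 0 (-conj (G 1))
        + π * (crossJet b (G 0) (G 1) (∫ y in (0:ℝ)..1, G y)).re := by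
  have hB1 := two_mul_re_integral_deriv_mul_conj hG
  have hB3 := two_mul_re_integral_mul_conj_primitive hG.cont
  rw [bulkFormOn_tailPrim_eq_re_shiftCore b hG, re_shiftCore_self, DictShift, DictS, SixMomentS]
  simp only [shiftRecipe]
  rw [sum_shiftW_mul_shiftS, sum_shiftW_mul_shiftN_add, sum_shiftW_mul_b_mul_shiftN,
    intervalIntegral_mul_conj_self G', intervalIntegral_mul_conj_self G, freeEndForm, freeEndForm, crossJet]
  rw [← atomA0, ← atomAb, ← atomAN]
  have hII : (∫ y in (0:ℝ)..1, G y) * conj (∫ y in (0:ℝ)..1, G y)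
      = ((‖∫ y in (0:ℝ)..1, G y‖ ^ 2 : ℝ) : ℂ) := by
    rw [Complex.mul_conj']; push_cast; rfl
  rw [hII]
  set Ig : ℂ := ∫ y in (0:ℝ)..1, G y with hIg
  set A4 : ℂ := ∫ x in (0:ℝ)..1, G x * conj (G' x) with hA4def
  set A2 : ℂ := ∫ x in (0:ℝ)..1, G' x * conj (G x) with hA2def
  set P7 : ℂ := ∫ x in (0:ℝ)..1, G x * conj (∫ t in (0:ℝ)..x, G t) with hP7
  have hA4 : A4 = conj A2 := integral_mul_conj_deriv_eq_conj G G'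
  have hA2re : A2.re = (‖G 1‖ ^ 2 - ‖G 0‖ ^ 2) / 2 := by linarith [hB1]
  have hP7re : P7.re = ‖Ig‖ ^ 2 / 2 := by linarith [hB3]
  rw [hA4]
  simp only [Complex.add_re, Complex.sub_re, Complex.mul_re, Complex.add_im, Complex.sub_im, Complex.mul_im,
    Complex.conj_re, Complex.conj_im, Complex.ofReal_re, Complex.ofReal_im, Complex.I_re, Complex.I_im,
    Complex.neg_re, Complex.neg_im, norm_neg, Complex.norm_conj, norm_zero, Complex.zero_re, Complex.zero_im,
    symE1, symE2, symE3]
  try simp only [← Complex.ofReal_pow, Complex.ofReal_re, Complex.ofReal_im]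
  rw [hA2re, hP7re]
  have hπ : (π : ℝ) ≠ 0 := Real.pi_ne_zero
  have hn0 : ‖G 0‖ ^ 2 = (G 0).re ^ 2 + (G 0).im ^ 2 := by rw [Complex.sq_norm, Complex.normSq_apply]; ring
  have hn1 : ‖G 1‖ ^ 2 = (G 1).re ^ 2 + (G 1).im ^ 2 := by rw [Complex.sq_norm, Complex.normSq_apply]; ring
  have hnI : ‖Ig‖ ^ 2 = Ig.re ^ 2 + Ig.im ^ 2 := by rw [Complex.sq_norm, Complex.normSq_apply]; ring
  rw [hn0, hn1, hnI]
  field_simp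
  ring

/-! ### Part 2 — the circle: glue a unit bridge to the tail primitive, apply K3′ -/

section Bridge

variable {E E' E'' : ℝ → ℂ}

/-- The tail primitive of a kinked profile is continuous on `[0,1]` and has right-derivative `−G` inside
(no apex condition; cf. `rightPiece_of_kinked`). [cite: Zhang2022LandauSiegel, Prop 7.1 p.44 with (8.11)–(8.12)] -/
theorem tailPrim_continuousOn_hasDeriv (hG : KinkedProfile G G') :
    ContinuousOn (tailPrim G) (Icc (0:ℝ) 1) ∧ ∀ y ∈ Ioo (0:ℝ) 1, HasDerivWithinAt (tailPrim G) (-G y) (Ioi y) y := by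
  have hgc : ContinuousOn (fun y => -G y) (Icc (0:ℝ) 1) := hG.cont.neg
  have hgi : IntervalIntegrable G volume 0 1 := (hG.cont.mono (by rw [uIcc_of_le zero_le_one])).intervalIntegrable
  have hrep : ∀ y ∈ Icc (0:ℝ) 1, tailPrim G y = tailPrim G 0 + ∫ t in (0:ℝ)..y, (fun t => -G t) t := by
    intro y hy
    rw [tailPrim_eq_sub hgi hy, tailPrim_zero, intervalIntegral.integral_neg]
    ring
  have hprim : ContinuousOn (fun y => tailPrim G 0 + ∫ t in (0:ℝ)..y, (fun t => -G t) t) (Icc (0:ℝ) 1) := by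
    have hint : IntervalIntegrable (fun t => -G t) volume 0 1 :=
      (hgc.mono (by rw [uIcc_of_le zero_le_one])).intervalIntegrable
    have := intervalIntegral.continuousOn_primitive_interval' hint (by simp : (0:ℝ) ∈ uIcc (0:ℝ) 1)
    rw [uIcc_of_le zero_le_one] at this
    exact continuousOn_const.add this
  exact ⟨hprim.congr fun y hy => hrep y hy, hasDerivWithinAt_Ioi_of_integral_repr hgc hrep⟩

/-- Continuity transported along `y ↦ y + 1`. [folklore] -/
private theorem continuousOn_comp_add_one' {F : ℝ → ℂ} (hF : ContinuousOn F (Icc 0 1)) :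
    ContinuousOn (fun y => F (y + 1)) (Icc (-1) 0) := by
  refine hF.comp (continuous_id.add continuous_const).continuousOn fun y hy => ?_
  exact ⟨by linarith [hy.1], by linarith [hy.2]⟩

/-- Right-derivatives transported along `y ↦ y + 1`. [folklore] -/
private theorem hasDerivWithinAt_comp_add_one' {F F' : ℝ → ℂ}
    (hF : ∀ y ∈ Ioo (0:ℝ) 1, HasDerivWithinAt F (F' y) (Ioi y) y) {y : ℝ} (hy : y ∈ Ioo (-1:ℝ) 0) :
    HasDerivWithinAt (fun y => F (y + 1)) (F' (y + 1)) (Ioi y) y := by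
  have hy' : y + 1 ∈ Ioo (0:ℝ) 1 := ⟨by linarith [hy.1], by linarith [hy.2]⟩
  have h := hF (y + 1) hy'
  have h2 : HasDerivWithinAt (fun t : ℝ => t + 1) (1:ℝ) (Ioi y) y := (hasDerivAt_id y).add_const 1 |>.hasDerivWithinAt
  have := h.scomp y h2 (fun t ht => by simpa using ht)
  rw [Function.comp_def] at this
  simpa using this

/-- Continuity of a glued function on `[−1,1]` from continuity of the pieces and matching at `0`. [folklore] -/
private theorem continuousOn_glue {fL fR : ℝ → ℂ} (hL : ContinuousOn fL (Icc (-1) 0)) (hR : ContinuousOn fR (Icc 0 1))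
    (h0 : fL 0 = fR 0) : ContinuousOn (glue fL fR) (Icc (-1) 1) := by
  unfold glue
  refine ContinuousOn.piecewise ?_ ?_ ?_
  · intro a ha
    rw [frontier_Iic] at ha
    have : a = 0 := ha.2
    subst this
    exact h0
  · rw [closure_Iic]
    refine hL.mono fun y hy => ⟨hy.1.1, hy.2⟩
  · rw [closure_compl, interior_Iic, compl_Iio]
    refine hR.mono fun y hy => ⟨hy.2, hy.1.2⟩

/-- A glued function has the left piece's right-derivative at points of `(−1, 0)`. [folklore] -/
private theorem hasDerivWithinAt_glue_left {fL fR : ℝ → ℂ} {d : ℂ} {y : ℝ} (hy : y ∈ Ioo (-1:ℝ) 0)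
    (h : HasDerivWithinAt fL d (Ioi y) y) : HasDerivWithinAt (glue fL fR) d (Ioi y) y := by
  refine h.congr_of_eventuallyEq ?_ (glue_of_le hy.2.le)
  have : Iio (0:ℝ) ∈ 𝓝[Ioi y] y := mem_nhdsWithin_of_mem_nhds (Iio_mem_nhds hy.2)
  filter_upwards [this] with t ht
  exact glue_of_le (le_of_lt ht)

/-- A glued function has the right piece's right-derivative at points of `(0, 1)`. [folklore] -/
private theorem hasDerivWithinAt_glue_right {fL fR : ℝ → ℂ} {d : ℂ} {y : ℝ} (hy : y ∈ Ioo (0:ℝ) 1)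
    (h : HasDerivWithinAt fR d (Ioi y) y) : HasDerivWithinAt (glue fL fR) d (Ioi y) y := by
  refine h.congr_of_eventuallyEq ?_ (glue_of_pos hy.1)
  have : Ioi (0:ℝ) ∈ 𝓝[Ioi y] y := mem_nhdsWithin_of_mem_nhds (Ioi_mem_nhds hy.1)
  filter_upwards [this] with t ht
  exact glue_of_pos ht

/-- The bulk form of glued data on the left half is the left piece's. [cite: Zhang2022LandauSiegel, Prop 7.1 p.44 with (8.11)–(8.23)] -/
private theorem bulkFormOn_glue_left (b : Fin 3 → ℝ) (SL SL' SL'' SR SR' SR'' : ℝ → ℂ) :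
    bulkFormOn b (-1) 0 (glue SL SR) (glue SL' SR') (glue SL'' SR'') = bulkFormOn b (-1) 0 SL SL' SL'' := by
  unfold bulkFormOn
  refine intervalIntegral.integral_congr fun y hy => ?_
  rw [uIcc_of_le (by norm_num)] at hy
  simp only [glue_of_le hy.2]

/-- The bulk form of glued data on the right half is the right piece's (agreement off the node `0`).
[cite: Zhang2022LandauSiegel, Prop 7.1 p.44 with (8.11)–(8.23)] -/
private theorem bulkFormOn_glue_right (b : Fin 3 → ℝ) (SL SL' SL'' SR SR' SR'' : ℝ → ℂ) :
    bulkFormOn b 0 1 (glue SL SR) (glue SL' SR') (glue SL'' SR'') = bulkFormOn b 0 1 SR SR' SR'' := by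
  unfold bulkFormOn
  refine intervalIntegral.integral_congr_ae ?_
  filter_upwards with y hy
  rw [uIoc_of_le zero_le_one] at hy
  simp only [glue_of_pos hy.1]

/-- **[K7, assembly — interface form] `DictShift_b(G) ≥ 0` from a unit bridge.** For a sign-admissible `b`, a kinked
profile `G` on `[0,1]` (no apex condition) and ANY bridge `E` on `[0,1]` — continuous `E, E′, E″`, right-derivatives
`E → E′ → E″`, jets `(E,E′)(0) = (0, −G(1))`, `(E,E′)(1) = (∫₀¹G, −G(0))`, energy
`Re A₀·T_b^{[0,1]}(E) = freeEndForm b I (−a₀) + freeEndForm b 0 (−conj a₁) + π·Re crossJet` — one has `0 ≤ DictShift b G G′`: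
glue `E(·+1)` on `[−1,0]` to `S_G` on `[0,1]` (periodic `C¹` data on the cell `[−1,1]`, node `0`), Parseval on the circle
(K3′ `bulkFormOn_circle_nonneg_of_signAdmissible`), `c₀ > 0`, and Part 1.
[cite: Zhang2022LandauSiegel, §4 (4.1); Prop 7.1 p.44 with (7.2), (8.11)–(8.23); §18 (18.1)] -/
theorem dictShift_nonneg_of_bridge (hb : SignAdmissible b) (hG : KinkedProfile G G')
    (hc : ContinuousOn E (Icc 0 1)) (hc' : ContinuousOn E' (Icc 0 1)) (hc'' : ContinuousOn E'' (Icc 0 1))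
    (hd : ∀ y ∈ Ioo (0:ℝ) 1, HasDerivWithinAt E (E' y) (Ioi y) y)
    (hd' : ∀ y ∈ Ioo (0:ℝ) 1, HasDerivWithinAt E' (E'' y) (Ioi y) y)
    (h0 : E 0 = 0) (h0' : E' 0 = -G 1) (h1 : E 1 = ∫ y in (0:ℝ)..1, G y) (h1' : E' 1 = -G 0)
    (hid : (atomA0 b).re * bulkFormOn b 0 1 E E' E''
      = freeEndForm b (∫ y in (0:ℝ)..1, G y) (-G 0) + freeEndForm b 0 (-conj (G 1))
        + π * (crossJet b (G 0) (G 1) (∫ y in (0:ℝ)..1, G y)).re) :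
    0 ≤ DictShift b G G' := by
  obtain ⟨hTc, hTd⟩ := tailPrim_continuousOn_hasDeriv hG
  -- the glued circle data on the cell `[−1, 1]`
  set S : ℝ → ℂ := glue (fun y => E (y + 1)) (tailPrim G) with hS
  set S' : ℝ → ℂ := glue (fun y => E' (y + 1)) (fun y => -G y) with hS'
  set S'' : ℝ → ℂ := glue (fun y => E'' (y + 1)) (fun y => -G' y) with hS''
  have hSc : ContinuousOn S (Icc (-1) 1) :=
    continuousOn_glue (continuousOn_comp_add_one' hc) hTc (by simp [h1, tailPrim_zero])
  have hS'c : ContinuousOn S' (Icc (-1) 1) :=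
    continuousOn_glue (continuousOn_comp_add_one' hc') hG.cont.neg (by simp [h1'])
  have hS''m : MemLp S'' 2 (volume.restrict (Ioc (-1:ℝ) 1)) :=
    memLp_glue (memLp_two_of_continuousOn_Icc' (continuousOn_comp_add_one' hc'')) hG.memLp.neg
  have hder1 : ∀ y ∈ Ioo (-1:ℝ) ((-1) + 2), y ∉ ({0} : Finset ℝ) → HasDerivWithinAt S (S' y) (Ioi y) y := by
    intro y hy hy0
    have hy0' : y ≠ 0 := by simpa using hy0
    rcases lt_or_gt_of_ne hy0' with hneg | hpos
    · have hyI : y ∈ Ioo (-1:ℝ) 0 := ⟨hy.1, hneg⟩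
      rw [hS', glue_of_le hneg.le]
      exact hasDerivWithinAt_glue_left hyI (hasDerivWithinAt_comp_add_one' hd hyI)
    · have hyI : y ∈ Ioo (0:ℝ) 1 := ⟨hpos, by linarith [hy.2]⟩
      rw [hS', glue_of_pos hpos]
      exact hasDerivWithinAt_glue_right hyI (hTd y hyI)
  have hder2 : ∀ y ∈ Ioo (-1:ℝ) ((-1) + 2), y ∉ ({0} : Finset ℝ) → HasDerivWithinAt S' (S'' y) (Ioi y) y := by
    intro y hy hy0
    have hy0' : y ≠ 0 := by simpa using hy0
    rcases lt_or_gt_of_ne hy0' with hneg | hpos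
    · have hyI : y ∈ Ioo (-1:ℝ) 0 := ⟨hy.1, hneg⟩
      rw [hS'', glue_of_le hneg.le]
      exact hasDerivWithinAt_glue_left hyI (hasDerivWithinAt_comp_add_one' hd' hyI)
    · have hyI : y ∈ Ioo (0:ℝ) 1 := ⟨hpos, by linarith [hy.2]⟩
      rw [hS'', glue_of_pos hpos]
      exact hasDerivWithinAt_glue_right hyI ((hG.hasDeriv y hyI).neg)
  have hp0 : S (-1) = S ((-1) + 2) := by
    rw [hS, glue_of_le (by norm_num), glue_of_pos (by norm_num)]
    norm_num [h0, tailPrim_one]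
  have hp1 : S' (-1) = S' ((-1) + 2) := by
    rw [hS', glue_of_le (by norm_num), glue_of_pos (by norm_num)]
    norm_num [h0']
  have h12 : ((-1:ℝ) + 2) = 1 := by norm_num
  have hcircle := bulkFormOn_circle_nonneg_of_signAdmissible hb (-1) ({0} : Finset ℝ) (S := S) (S' := S') (S'' := S'')
    (by rw [h12]; exact hSc) (by rw [h12]; exact hS'c) hder1 hder2 (by rw [h12]; exact hS''m) hp0 hp1
  rw [h12, bulkFormOn_add_adjacent b (x := 0) (by norm_num) hSc hS'c hS''m, hS, hS', hS'', bulkFormOn_glue_left,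
    bulkFormOn_glue_right, bulkFormOn_comp_add_one] at hcircle
  -- `c₀ > 0`, Part 1 and the bridge energy
  have hc0 : 0 < (atomA0 b).re := by unfold atomA0; exact re_sum_shiftW_pos hb
  have hK1 := dictShift_eq_bulk_add_jets b hG
  have key : π / 2 * DictShift b G G'
      = (atomA0 b).re * (bulkFormOn b 0 1 E E' E''
          + bulkFormOn b 0 1 (tailPrim G) (fun y => -G y) (fun y => -G' y)) := by
    rw [hK1, mul_add, hid]; ring
  have hπ : 0 < π / 2 := by positivity
  nlinarith [mul_nonneg hc0.le hcircle, key]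

/-- **[K7] interface form, as a slot on kinked profiles:** if for every jet datum `(a₀, a₁, I)` a bridge as above exists,
then `0 ≤ DictShift b G G′` for EVERY kinked `G` (sign-admissible `b`).
[cite: Zhang2022LandauSiegel, §4 (4.1); Prop 7.1 p.44 with (7.2), (8.11)–(8.23); §18 (18.1)] -/
theorem dictShift_nonneg_kinked_of_bridges (hb : SignAdmissible b)
    (hK2 : ∀ a₀ a₁ Ig : ℂ, ∃ E E' E'' : ℝ → ℂ,
      ContinuousOn E (Icc 0 1) ∧ ContinuousOn E' (Icc 0 1) ∧ ContinuousOn E'' (Icc 0 1) ∧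
      (∀ y ∈ Ioo (0:ℝ) 1, HasDerivWithinAt E (E' y) (Ioi y) y) ∧
      (∀ y ∈ Ioo (0:ℝ) 1, HasDerivWithinAt E' (E'' y) (Ioi y) y) ∧
      E 0 = 0 ∧ E' 0 = -a₁ ∧ E 1 = Ig ∧ E' 1 = -a₀ ∧
      (atomA0 b).re * bulkFormOn b 0 1 E E' E''
        = freeEndForm b Ig (-a₀) + freeEndForm b 0 (-conj a₁) + π * (crossJet b a₀ a₁ Ig).re)
    (hG : KinkedProfile G G') : 0 ≤ DictShift b G G' := by
  obtain ⟨E, E', E'', hc, hc', hc'', hd, hd', h0, h0', h1, h1', hid⟩ := hK2 (G 0) (G 1) (∫ y in (0:ℝ)..1, G y)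
  exact dictShift_nonneg_of_bridge hb hG hc hc' hc'' hd hd' h0 h0' h1 h1' hid

end Bridge

end Det

end Literature.NumberTheory.LFunctions.Zhang2022
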